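import Summits.AnomalousDissipation.AnomalousDissipation.Theorems.DopplerClockQuadratureStressFloorLaminarCalibration
import Summits.AnomalousDissipation.AnomalousDissipation.Theorems.DopplerClockDopplerWorkIdentity
import Summits.AnomalousDissipation.AnomalousDissipation.Theorems.DopplerClockLongitudinalClassQuietModes
import Literature.Analysis.FluidPDE.TorusClassicalLerayHopfProofs
import Literature.Analysis.FluidPDE.DoeringFoiasPowerProofs
import Summits.AnomalousDissipation.AnomalousDissipation.Theorems.ImpulseGridGridSignsLawSteadyNecessary

/-!
# Crux `DopplerClock.QuadratureStressFloor` (stmt-AnomalousDissipation-18129) — negative side, II: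
# laminar witnesses, the load-bearing momentum pinning, and the guards `0 < m`, `0 < n`

Negative-side support from the cdisprove seat (`refuter-cdisprove-stmt-AnomalousDissipation-18129-0`),
companion of `Negative/DissipationFloor.lean`.  Kernel-checked facts about the clause structure of
the EXISTENTIAL crux C1 (`w_j = u_j − V e₂`, `T_s(w) = ∫⟪w, (w·∇)Ψ_s⟫`,
`Ψ_s = sin(2πm x₁) sin(2πn x₂) e₀`, `Ψ_c = sin(2πm x₁) cos(2πn x₂) e₀`):

* `laminar_clauses_stress_zero` — for EVERY design and EVERY sequence of positive viscosities the
  drifted laminar streak arrays of item 18132 (`dopplerClock_laminarStreaks_proof`) satisfy clauses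
  (i)–(v) of C1 — global Leray–Hopf (classical ⇒ Leray–Hopf), momentum `V e₂`, bounded energy, NO
  leakage (steady energy identity, with equality) — and their stress `T_s(u_L − V e₂)` vanishes at
  every time (`u_L − V e₂ ∥ e₀`, `∂₀Ψ_s = 0`).  Hence `quadratureStressFloor_holds_without_floor`
  (the hypotheses of C1 are jointly satisfiable and carry no information: the floor is the whole
  content) and `not_quadratureStressFloor_forall_families` (the `∀`-families strengthening of C1 is
  false even with `Λ`, `ε₀` depending on the family: a proof must SELECT loud witnesses).
* `quadratureStressFloor_holds_without_momentumPinning` — **the frame pinning is load-bearing**: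
  delete the single clause `∫ u₀ⱼ = V e₂` and the statement becomes TRUE by the UNDRIFTED laminar
  Kolmogorov-type states `U_j = a_j Ψ_c`, `a_j = F/(ν_jκ²)`, for which
  `−T_s(U_j − V e₂) = 2πnV a_j/4 → +∞`: the floor functional measures the mismatch between the frame
  `V` of `T_s` and the momentum of the witness unless the two are tied — exactly the clause the
  work identity (item 18133) consumes.
* `not_stressFloor_of_m_eq_zero`, `not_stressFloor_of_n_eq_zero` — at `m = 0` or `n = 0` the
  pattern `Ψ_s` vanishes identically, `T_s ≡ 0` for every field, and the floor clause is
  unsatisfiable for every `V`, `Λ` and every family: the guards are necessary, not cosmetic.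

No new definitions; the two `…_holds_without_…` theorems are the crux with a clause DELETED (not
Theses statements), proved by laminar states.  References: Foias–Manley–Rosa–Temam 2001 Ch. II §2
(laminar Kolmogorov-type states), Ch. IV §1; Doering–Foias 2002 §2; Marchioro 1986;
Robinson–Rodrigo–Sadowski 2016 Thm. 6.5.
-/
noncomputable section

-- `Summit.<Summit>.<Problem>` is the tree's mandated summit-side namespace (CONVENTIONS §2); for this
-- single-conjunct summit the two coincide, so the duplicate is deliberate.
set_option linter.dupNamespace false

open MeasureTheory Set Filter Topology
open scoped InnerProductSpace RealInnerProductSpace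

namespace Summit.AnomalousDissipation.AnomalousDissipation.Theorems.QuadratureStressFloor.Negative

open Literature.Analysis.FunctionSpaces Literature.Analysis.FunctionSpaces.Torus
open Literature.Analysis.FluidPDE Literature.Analysis.FluidPDE.Torus
open Summit.AnomalousDissipation.AnomalousDissipation.Theorems


/-! ### (c) The laminar family: clauses (i)–(v) hold with identically vanishing stress -/

/-- `DΨ_s(x)[e₀] = ∂₀Ψ_s(x) = 0`: the streak pattern does not depend on `x₀`. [folklore] -/
theorem fderiv_pattern_single_zero (m n : ℕ) (x : UnitAddTorus (Fin 3)) :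
    Torus.fderiv (fun y : UnitAddTorus (Fin 3) => ((UnitAddTorus.mFourier (Pi.single (1 : Fin 3) ((m : ℕ) : ℤ)) y).im * (UnitAddTorus.mFourier (Pi.single (2 : Fin 3) ((n : ℕ) : ℤ)) y).im) • EuclideanSpace.single (0 : Fin 3) (1 : ℝ)) x (EuclideanSpace.single (0 : Fin 3) (1 : ℝ)) = 0 := by
  rw [← partialDeriv_eq_fderiv_apply ((DopplerWork.pattern_regular m n).1.isContDiff (by simp)) 0 x]
  exact DopplerStreaks.partialDeriv_zero_sinSin m n x

/-- **Transport of the streak pattern by a streak-plus-drift field**: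
`((r e₀ + A e₂)·∇)Ψ_s = A ∂₂Ψ_s = A · 2πn Ψ_c` (`DΨ_s[e₀] = 0`, `∂₂Ψ_s = 2πn Ψ_c`). [folklore] -/
theorem convect_streak_pattern (m n : ℕ) (r : UnitAddTorus (Fin 3) → ℝ) (A : ℝ) (x : UnitAddTorus (Fin 3)) :
    convect (fun y : UnitAddTorus (Fin 3) => r y • EuclideanSpace.single (0 : Fin 3) (1 : ℝ) + A • EuclideanSpace.single (2 : Fin 3) (1 : ℝ)) (fun y : UnitAddTorus (Fin 3) => ((UnitAddTorus.mFourier (Pi.single (1 : Fin 3) ((m : ℕ) : ℤ)) y).im * (UnitAddTorus.mFourier (Pi.single (2 : Fin 3) ((n : ℕ) : ℤ)) y).im) • EuclideanSpace.single (0 : Fin 3) (1 : ℝ)) x =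
      A • ((2 * Real.pi * n * ((UnitAddTorus.mFourier (Pi.single (1 : Fin 3) ((m : ℕ) : ℤ)) x).im * (UnitAddTorus.mFourier (Pi.single (2 : Fin 3) ((n : ℕ) : ℤ)) x).re)) • EuclideanSpace.single (0 : Fin 3) (1 : ℝ)) := by
  have h1 : IsContDiff 1 (fun y : UnitAddTorus (Fin 3) => ((UnitAddTorus.mFourier (Pi.single (1 : Fin 3) ((m : ℕ) : ℤ)) y).im * (UnitAddTorus.mFourier (Pi.single (2 : Fin 3) ((n : ℕ) : ℤ)) y).im) • EuclideanSpace.single (0 : Fin 3) (1 : ℝ)) :=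
    (DopplerWork.pattern_regular m n).1.isContDiff (by simp)
  unfold Torus.convect
  rw [map_add, map_smul, map_smul, fderiv_pattern_single_zero, smul_zero, zero_add,
    ← partialDeriv_eq_fderiv_apply h1 2 x, DopplerWork.partialDeriv_two_pattern]

/-- **The stress of a pure streak field vanishes**: `T_s(r e₀) = ∫⟪r e₀, ((r e₀)·∇)Ψ_s⟫ = 0`
pointwise, since `((r e₀)·∇)Ψ_s = r ∂₀Ψ_s = 0`. [folklore] -/
theorem stress_streak_eq_zero (m n : ℕ) (r : UnitAddTorus (Fin 3) → ℝ) :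
    ∫ x, ⟪r x • EuclideanSpace.single (0 : Fin 3) (1 : ℝ), convect (fun y : UnitAddTorus (Fin 3) => r y • EuclideanSpace.single (0 : Fin 3) (1 : ℝ)) (fun y : UnitAddTorus (Fin 3) => ((UnitAddTorus.mFourier (Pi.single (1 : Fin 3) ((m : ℕ) : ℤ)) y).im * (UnitAddTorus.mFourier (Pi.single (2 : Fin 3) ((n : ℕ) : ℤ)) y).im) • EuclideanSpace.single (0 : Fin 3) (1 : ℝ)) x⟫ = 0 := by
  have h : ∀ x : UnitAddTorus (Fin 3), convect (fun y : UnitAddTorus (Fin 3) => r y • EuclideanSpace.single (0 : Fin 3) (1 : ℝ)) (fun y : UnitAddTorus (Fin 3) => ((UnitAddTorus.mFourier (Pi.single (1 : Fin 3) ((m : ℕ) : ℤ)) y).im * (UnitAddTorus.mFourier (Pi.single (2 : Fin 3) ((n : ℕ) : ℤ)) y).im) • EuclideanSpace.single (0 : Fin 3) (1 : ℝ)) x = 0 := by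
    intro x
    have := convect_streak_pattern m n r 0 x
    simp only [zero_smul, add_zero] at this
    exact this
  simp [h]

/-- **The drifted laminar family meets clauses (i)–(v) of C1 with identically vanishing stress.**
For EVERY design (`V > 0`, `n ≥ 1`, any `F`, `m`) and EVERY sequence of positive viscosities, the
steady streak arrays `u_L(ν_j) = V e₂ + sin(2πm x₁)[a_j cos + b_j sin](2πn x₂) e₀` of item 18132
(`dopplerClock_laminarStreaks_proof`) are global Leray–Hopf solutions (classical ⇒ Leray–Hopf,
Robinson–Rodrigo–Sadowski 2016 Thm. 6.5) with momentum `V e₂`, bounded energy and NO leakage (steady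
energy identity `ν‖∇u_L‖² = (f, u_L)`, spectral = pointwise gradient norm on the smooth slice), and
their quadrature stress `T_s(u_L − V e₂)` vanishes at every time (`u_L − V e₂ ∥ e₀`, `∂₀Ψ_s = 0`).
So the hypotheses (i)–(v) of the crux are jointly satisfiable and carry no information by
themselves: the floor clause is the whole content. [folklore] -/
theorem laminar_clauses_stress_zero (F V : ℝ) (m n : ℕ) (hV : 0 < V) (hn : 0 < n) (ν : ℕ → ℝ)
    (hν : ∀ j, 0 < ν j) :
    ∃ (u₀ : ℕ → UnitAddTorus (Fin 3) → EuclideanSpace ℝ (Fin 3)) (u : ℕ → ℝ → UnitAddTorus (Fin 3) → EuclideanSpace ℝ (Fin 3)),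
      (∀ j, IsGlobalLerayHopf (ν j) (fun _ => fun x : UnitAddTorus (Fin 3) => (F * (UnitAddTorus.mFourier (Pi.single (1 : Fin 3) ((m : ℕ) : ℤ)) x).im * (UnitAddTorus.mFourier (Pi.single (2 : Fin 3) ((n : ℕ) : ℤ)) x).re) • EuclideanSpace.single (0 : Fin 3) (1 : ℝ))
        (u₀ j) (u j)) ∧
      (∀ j, ∫ x, u₀ j x = V • EuclideanSpace.single (2 : Fin 3) (1 : ℝ)) ∧
      (∀ j, ∃ C : ℝ, ∀ t : ℝ, 0 ≤ t → kineticEnergy (u j t) ≤ C) ∧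
      (∀ j, longTimeAvgSup (fun t => ∫ x, ⟪(F * (UnitAddTorus.mFourier (Pi.single (1 : Fin 3) ((m : ℕ) : ℤ)) x).im * (UnitAddTorus.mFourier (Pi.single (2 : Fin 3) ((n : ℕ) : ℤ)) x).re) • EuclideanSpace.single (0 : Fin 3) (1 : ℝ), u j t x⟫) ≤
        meanDissipation (ν j) (u j)) ∧
      ∀ j (t : ℝ), ∫ x, ⟪u j t x - V • EuclideanSpace.single (2 : Fin 3) (1 : ℝ),
        convect (fun y => u j t y - V • EuclideanSpace.single (2 : Fin 3) (1 : ℝ)) (fun y : UnitAddTorus (Fin 3) => ((UnitAddTorus.mFourier (Pi.single (1 : Fin 3) ((m : ℕ) : ℤ)) y).im * (UnitAddTorus.mFourier (Pi.single (2 : Fin 3) ((n : ℕ) : ℤ)) y).im) • EuclideanSpace.single (0 : Fin 3) (1 : ℝ)) x⟫ = 0 := by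
  -- the streak amplitudes and the laminar states
  set κ2 : ℝ := (2 * Real.pi) ^ 2 * ((m : ℝ) ^ 2 + (n : ℝ) ^ 2) with hκ2def
  set a : ℕ → ℝ := fun j => F * ν j * κ2 / (V ^ 2 * (2 * Real.pi * n) ^ 2 + ν j ^ 2 * κ2 ^ 2) with hadef
  set b : ℕ → ℝ := fun j => F * V * (2 * Real.pi * n) / (V ^ 2 * (2 * Real.pi * n) ^ 2 + ν j ^ 2 * κ2 ^ 2)
    with hbdef
  set r : ℕ → UnitAddTorus (Fin 3) → ℝ := fun j x => (UnitAddTorus.mFourier (Pi.single (1 : Fin 3) ((m : ℕ) : ℤ)) x).im * (a j * (UnitAddTorus.mFourier (Pi.single (2 : Fin 3) ((n : ℕ) : ℤ)) x).re + b j * (UnitAddTorus.mFourier (Pi.single (2 : Fin 3) ((n : ℕ) : ℤ)) x).im) with hrdef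
  set U : ℕ → UnitAddTorus (Fin 3) → EuclideanSpace ℝ (Fin 3) := fun j x => V • EuclideanSpace.single (2 : Fin 3) (1 : ℝ) + r j x • EuclideanSpace.single (0 : Fin 3) (1 : ℝ) with hUdef
  have hNS : ∀ j, IsClassicalNSSolutionOn univ (ν j)
      (fun _ => fun x : UnitAddTorus (Fin 3) => (F * (UnitAddTorus.mFourier (Pi.single (1 : Fin 3) ((m : ℕ) : ℤ)) x).im * (UnitAddTorus.mFourier (Pi.single (2 : Fin 3) ((n : ℕ) : ℤ)) x).re) • EuclideanSpace.single (0 : Fin 3) (1 : ℝ)) (fun _ => U j) (fun _ _ => (0 : ℝ)) ∧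
      ∫ x, U j x = V • EuclideanSpace.single (2 : Fin 3) (1 : ℝ) ∧ kineticEnergy (U j) ≤ V ^ 2 / 2 + F ^ 2 / (8 * V ^ 2 * (2 * Real.pi * n) ^ 2) :=
    fun j => dopplerClock_laminarStreaks_proof F V (ν j) m n hV (hν j) hn
  refine ⟨U, fun j _ => U j, fun j => (hNS j).1.isGlobalLerayHopf, fun j => (hNS j).2.1,
    fun j => ⟨_, fun t _ => le_rfl⟩, fun j => ?_, fun j t => ?_⟩
  · -- no leakage (with equality): `⟨(f,u_L)⟩⁺ = (f,u_L) = ν‖∇u_L‖² = meanDissipation`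
    have hsm : IsSmooth (U j) := (hNS j).1.smooth_velocity.isSmooth_slice (Set.mem_univ (0 : ℝ))
    have hE := (hNS j).1.energy_eq convex_univ (zero_le_one (α := ℝ)) (Set.subset_univ _)
    simp only [intervalIntegral.integral_const, sub_zero, one_smul] at hE
    change longTimeAvgSup (fun _ : ℝ => ∫ x, ⟪(F * (UnitAddTorus.mFourier (Pi.single (1 : Fin 3) ((m : ℕ) : ℤ)) x).im * (UnitAddTorus.mFourier (Pi.single (2 : Fin 3) ((n : ℕ) : ℤ)) x).re) • EuclideanSpace.single (0 : Fin 3) (1 : ℝ), U j x⟫) ≤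
      meanDissipation (ν j) (fun _ : ℝ => U j)
    rw [show longTimeAvgSup _ = _ from (steady_tendsto_timeMean_const _).limsup_eq,
      LaminarCalibration.meanDissipation_steady (ν j) hsm]
    linarith
  · -- the stress vanishes: `u_L − V e₂ = r e₀`
    change ∫ x, ⟪U j x - V • EuclideanSpace.single (2 : Fin 3) (1 : ℝ), convect (fun y => U j y - V • EuclideanSpace.single (2 : Fin 3) (1 : ℝ))
      (fun y : UnitAddTorus (Fin 3) => ((UnitAddTorus.mFourier (Pi.single (1 : Fin 3) ((m : ℕ) : ℤ)) y).im * (UnitAddTorus.mFourier (Pi.single (2 : Fin 3) ((n : ℕ) : ℤ)) y).im) • EuclideanSpace.single (0 : Fin 3) (1 : ℝ)) x⟫ = 0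
    have hw : (fun y => U j y - V • EuclideanSpace.single (2 : Fin 3) (1 : ℝ)) = fun y => r j y • EuclideanSpace.single (0 : Fin 3) (1 : ℝ) := by
      funext y
      simp [hUdef]
    have hw' : ∀ x, U j x - V • EuclideanSpace.single (2 : Fin 3) (1 : ℝ) = r j x • EuclideanSpace.single (0 : Fin 3) (1 : ℝ) := fun x => congrFun hw x
    simp_rw [hw']
    exact stress_streak_eq_zero m n (r j)

/-- **C1 without its floor clause is (trivially) TRUE**: clauses (i)–(v) of `QuadratureStressFloor`
are met by the drifted laminar family at `ν_j = 1/(j+1)` (any admissible design, any generalized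
limit). Recorded to certify that the hypotheses of the crux are satisfiable and that nothing but the
floor is at stake. [folklore] -/
theorem quadratureStressFloor_holds_without_floor :
    ∃ (F V : ℝ) (m n : ℕ), 0 < F ∧ 0 < V ∧ 0 < m ∧ 0 < n ∧ ∃ (_Λ : GeneralizedLimit),
      ∃ (ν : ℕ → ℝ) (u₀ : ℕ → UnitAddTorus (Fin 3) → EuclideanSpace ℝ (Fin 3)) (u : ℕ → ℝ → UnitAddTorus (Fin 3) → EuclideanSpace ℝ (Fin 3)),
        (∀ j, 0 < ν j) ∧ Tendsto ν atTop (𝓝 0) ∧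
        (∀ j, IsGlobalLerayHopf (ν j) (fun _ => fun x : UnitAddTorus (Fin 3) => (F * (UnitAddTorus.mFourier (Pi.single (1 : Fin 3) ((m : ℕ) : ℤ)) x).im * (UnitAddTorus.mFourier (Pi.single (2 : Fin 3) ((n : ℕ) : ℤ)) x).re) • EuclideanSpace.single (0 : Fin 3) (1 : ℝ))
          (u₀ j) (u j)) ∧
        (∀ j, ∫ x, u₀ j x = V • EuclideanSpace.single (2 : Fin 3) (1 : ℝ)) ∧
        (∀ j, ∃ C : ℝ, ∀ t : ℝ, 0 ≤ t → kineticEnergy (u j t) ≤ C) ∧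
        (∀ j, longTimeAvgSup (fun t => ∫ x, ⟪(F * (UnitAddTorus.mFourier (Pi.single (1 : Fin 3) ((m : ℕ) : ℤ)) x).im * (UnitAddTorus.mFourier (Pi.single (2 : Fin 3) ((n : ℕ) : ℤ)) x).re) • EuclideanSpace.single (0 : Fin 3) (1 : ℝ), u j t x⟫) ≤
          meanDissipation (ν j) (u j)) := by
  obtain ⟨Λ⟩ := (GeneralizedLimit.nonempty_holds : Nonempty GeneralizedLimit)
  have hν : ∀ j : ℕ, (0 : ℝ) < 1 / ((j : ℝ) + 1) := fun j => by positivity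
  obtain ⟨u₀, u, hLH, hmom, hsup, hnoleak, -⟩ :=
    laminar_clauses_stress_zero 1 1 1 1 one_pos one_pos (fun j => 1 / ((j : ℝ) + 1)) hν
  exact ⟨1, 1, 1, 1, one_pos, one_pos, one_pos, one_pos, Λ, fun j => 1 / ((j : ℝ) + 1), u₀, u, hν,
    tendsto_one_div_add_atTop_nhds_zero_nat, hLH, hmom, hsup, hnoleak⟩

/-- **The `∀`-families strengthening of C1 is FALSE** (even in its weakest form, with the generalized
limit and the floor allowed to depend on the family): for every admissible design the drifted laminar
family is an admissible family (clauses (i)–(v)) whose stress vanishes identically, so no `ε₀ > 0`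
bounds `−Λ⟨T_s(w_j)⟩ = 0` from below. The existential over families in C1 is essential: a proof
must SELECT loud witnesses, it cannot argue from the clauses. [folklore] -/
theorem not_quadratureStressFloor_forall_families :
    ¬ ∃ (F V : ℝ) (m n : ℕ), 0 < F ∧ 0 < V ∧ 0 < m ∧ 0 < n ∧
      ∀ (ν : ℕ → ℝ) (u₀ : ℕ → UnitAddTorus (Fin 3) → EuclideanSpace ℝ (Fin 3)) (u : ℕ → ℝ → UnitAddTorus (Fin 3) → EuclideanSpace ℝ (Fin 3)),
        (∀ j, 0 < ν j) → Tendsto ν atTop (𝓝 0) →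
        (∀ j, IsGlobalLerayHopf (ν j) (fun _ => fun x : UnitAddTorus (Fin 3) => (F * (UnitAddTorus.mFourier (Pi.single (1 : Fin 3) ((m : ℕ) : ℤ)) x).im * (UnitAddTorus.mFourier (Pi.single (2 : Fin 3) ((n : ℕ) : ℤ)) x).re) • EuclideanSpace.single (0 : Fin 3) (1 : ℝ))
          (u₀ j) (u j)) →
        (∀ j, ∫ x, u₀ j x = V • EuclideanSpace.single (2 : Fin 3) (1 : ℝ)) →
        (∀ j, ∃ C : ℝ, ∀ t : ℝ, 0 ≤ t → kineticEnergy (u j t) ≤ C) →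
        (∀ j, longTimeAvgSup (fun t => ∫ x, ⟪(F * (UnitAddTorus.mFourier (Pi.single (1 : Fin 3) ((m : ℕ) : ℤ)) x).im * (UnitAddTorus.mFourier (Pi.single (2 : Fin 3) ((n : ℕ) : ℤ)) x).re) • EuclideanSpace.single (0 : Fin 3) (1 : ℝ), u j t x⟫) ≤
          meanDissipation (ν j) (u j)) →
        ∃ (Λ : GeneralizedLimit) (ε₀ : ℝ), 0 < ε₀ ∧ ∀ j, ε₀ ≤ -Λ.longTimeAvg (fun t => ∫ x, ⟪u j t x - V • EuclideanSpace.single (2 : Fin 3) (1 : ℝ),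
          convect (fun y => u j t y - V • EuclideanSpace.single (2 : Fin 3) (1 : ℝ)) (fun y : UnitAddTorus (Fin 3) => ((UnitAddTorus.mFourier (Pi.single (1 : Fin 3) ((m : ℕ) : ℤ)) y).im * (UnitAddTorus.mFourier (Pi.single (2 : Fin 3) ((n : ℕ) : ℤ)) y).im) • EuclideanSpace.single (0 : Fin 3) (1 : ℝ)) x⟫) := by
  rintro ⟨F, V, m, n, -, hV, -, hn, hall⟩
  have hν : ∀ j : ℕ, (0 : ℝ) < 1 / ((j : ℝ) + 1) := fun j => by positivity
  obtain ⟨u₀, u, hLH, hmom, hsup, hnoleak, hzero⟩ :=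
    laminar_clauses_stress_zero F V m n hV hn (fun j => 1 / ((j : ℝ) + 1)) hν
  obtain ⟨Λ, ε₀, hε₀, hfloor⟩ :=
    hall (fun j => 1 / ((j : ℝ) + 1)) u₀ u hν tendsto_one_div_add_atTop_nhds_zero_nat hLH hmom hsup hnoleak
  have h0 := hfloor 0
  simp_rw [hzero 0] at h0
  rw [steady_longTimeAvg_const Λ 0, neg_zero] at h0
  exact absurd h0 (not_le.2 hε₀)

/-! ### (d) The frame pinning `∫ u₀ⱼ = V e₂` is load-bearing -/

/-- **C1 without the momentum pinning is TRUE, by undrifted laminar states.** Delete the single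
clause `∫ u₀ⱼ = V e₂` from `QuadratureStressFloor`; then with the design `F = V = 1`, `m = n = 1`,
`ν_j = 1/(j+1)` the UNDRIFTED steady Kolmogorov-type states `U_j = a_j Ψ_c`, `a_j = 1/(ν_j κ²)`,
`κ² = 8π²` (classical steady solutions: `νκ² a = F`, zero drift) are global Leray–Hopf, have bounded
energy and no leakage (steady energy identity), and their stress about the frame `V e₂` is
`T_s(U_j − V e₂) = −2πnV a_j ∫(sin·cos)² = −(j+1)/(16π)`, so `ε₀ = 1/(16π)` is a floor. The frame
velocity `V` of `T_s` and the momentum of the witnesses must be tied for the crux to mean anything —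
exactly the clause the work identity (item 18133) consumes. [folklore] -/
theorem quadratureStressFloor_holds_without_momentumPinning :
    ∃ (F V : ℝ) (m n : ℕ), 0 < F ∧ 0 < V ∧ 0 < m ∧ 0 < n ∧ ∃ (Λ : GeneralizedLimit),
      ∃ (ν : ℕ → ℝ) (u₀ : ℕ → UnitAddTorus (Fin 3) → EuclideanSpace ℝ (Fin 3)) (u : ℕ → ℝ → UnitAddTorus (Fin 3) → EuclideanSpace ℝ (Fin 3)),
        (∀ j, 0 < ν j) ∧ Tendsto ν atTop (𝓝 0) ∧
        (∀ j, IsGlobalLerayHopf (ν j) (fun _ => fun x : UnitAddTorus (Fin 3) => (F * (UnitAddTorus.mFourier (Pi.single (1 : Fin 3) ((m : ℕ) : ℤ)) x).im * (UnitAddTorus.mFourier (Pi.single (2 : Fin 3) ((n : ℕ) : ℤ)) x).re) • EuclideanSpace.single (0 : Fin 3) (1 : ℝ))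
          (u₀ j) (u j)) ∧
        (∀ j, ∃ C : ℝ, ∀ t : ℝ, 0 ≤ t → kineticEnergy (u j t) ≤ C) ∧
        (∀ j, longTimeAvgSup (fun t => ∫ x, ⟪(F * (UnitAddTorus.mFourier (Pi.single (1 : Fin 3) ((m : ℕ) : ℤ)) x).im * (UnitAddTorus.mFourier (Pi.single (2 : Fin 3) ((n : ℕ) : ℤ)) x).re) • EuclideanSpace.single (0 : Fin 3) (1 : ℝ), u j t x⟫) ≤
          meanDissipation (ν j) (u j)) ∧
        ∃ ε₀ : ℝ, 0 < ε₀ ∧ ∀ j, ε₀ ≤ -Λ.longTimeAvg (fun t => ∫ x, ⟪u j t x - V • EuclideanSpace.single (2 : Fin 3) (1 : ℝ),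
          convect (fun y => u j t y - V • EuclideanSpace.single (2 : Fin 3) (1 : ℝ)) (fun y : UnitAddTorus (Fin 3) => ((UnitAddTorus.mFourier (Pi.single (1 : Fin 3) ((m : ℕ) : ℤ)) y).im * (UnitAddTorus.mFourier (Pi.single (2 : Fin 3) ((n : ℕ) : ℤ)) y).im) • EuclideanSpace.single (0 : Fin 3) (1 : ℝ)) x⟫) := by
  obtain ⟨Λ⟩ := (GeneralizedLimit.nonempty_holds : Nonempty GeneralizedLimit)
  -- viscosities, amplitudes, the undrifted laminar states
  set ν : ℕ → ℝ := fun j => 1 / ((j : ℝ) + 1) with hνdef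
  have hν : ∀ j, 0 < ν j := fun j => by rw [hνdef]; positivity
  set κ2 : ℝ := (2 * Real.pi) ^ 2 * (((1 : ℕ) : ℝ) ^ 2 + ((1 : ℕ) : ℝ) ^ 2) with hκ2def
  have hκ2 : 0 < κ2 := by rw [hκ2def]; positivity
  set a : ℕ → ℝ := fun j => 1 / (ν j * κ2) with hadef
  have ha : ∀ j, 0 < a j := fun j => by rw [hadef]; exact div_pos one_pos (mul_pos (hν j) hκ2)
  set r : ℕ → UnitAddTorus (Fin 3) → ℝ := fun j x => (UnitAddTorus.mFourier (Pi.single (1 : Fin 3) ((1 : ℕ) : ℤ)) x).im * (a j * (UnitAddTorus.mFourier (Pi.single (2 : Fin 3) ((1 : ℕ) : ℤ)) x).re + 0 * (UnitAddTorus.mFourier (Pi.single (2 : Fin 3) ((1 : ℕ) : ℤ)) x).im) with hrdef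
  set U : ℕ → UnitAddTorus (Fin 3) → EuclideanSpace ℝ (Fin 3) := fun j x => (0 : ℝ) • EuclideanSpace.single (2 : Fin 3) (1 : ℝ) + r j x • EuclideanSpace.single (0 : Fin 3) (1 : ℝ) with hUdef
  have hNS : ∀ j, IsClassicalNSSolutionOn univ (ν j)
      (fun _ => fun x : UnitAddTorus (Fin 3) => ((1 : ℝ) * (UnitAddTorus.mFourier (Pi.single (1 : Fin 3) ((1 : ℕ) : ℤ)) x).im * (UnitAddTorus.mFourier (Pi.single (2 : Fin 3) ((1 : ℕ) : ℤ)) x).re) • EuclideanSpace.single (0 : Fin 3) (1 : ℝ)) (fun _ => U j) (fun _ _ => (0 : ℝ)) := by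
    intro j
    have h := DopplerStreaks.isClassicalNSSolutionOn_streaks 1 0 (ν j) (a j) 0 1 1 ?_ ?_
    · exact h
    · show 2 * Real.pi * ((1 : ℕ) : ℝ) * 0 * 0 + ν j * κ2 * (1 / (ν j * κ2)) = 1
      rw [mul_one_div, div_self (ne_of_gt (mul_pos (hν j) hκ2))]
      ring
    · ring
  -- the stress of `U_j − V e₂`, `V = 1`: a negative constant `−2π a_j / 4`
  have hstress : ∀ j, ∫ x, ⟪U j x - (1 : ℝ) • EuclideanSpace.single (2 : Fin 3) (1 : ℝ), convect (fun y => U j y - (1 : ℝ) • EuclideanSpace.single (2 : Fin 3) (1 : ℝ))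
      (fun y : UnitAddTorus (Fin 3) => ((UnitAddTorus.mFourier (Pi.single (1 : Fin 3) ((1 : ℕ) : ℤ)) y).im * (UnitAddTorus.mFourier (Pi.single (2 : Fin 3) ((1 : ℕ) : ℤ)) y).im) • EuclideanSpace.single (0 : Fin 3) (1 : ℝ)) x⟫ = -(2 * Real.pi * a j * 4⁻¹) := by
    intro j
    have hw : (fun y => U j y - (1 : ℝ) • EuclideanSpace.single (2 : Fin 3) (1 : ℝ)) = fun y => r j y • EuclideanSpace.single (0 : Fin 3) (1 : ℝ) + (-1 : ℝ) • EuclideanSpace.single (2 : Fin 3) (1 : ℝ) := by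
      funext y
      simp only [hUdef, zero_smul, zero_add, one_smul, neg_smul, sub_eq_add_neg]
    have hw' : ∀ x, U j x - (1 : ℝ) • EuclideanSpace.single (2 : Fin 3) (1 : ℝ) = r j x • EuclideanSpace.single (0 : Fin 3) (1 : ℝ) + (-1 : ℝ) • EuclideanSpace.single (2 : Fin 3) (1 : ℝ) := fun x => congrFun hw x
    simp_rw [hw', convect_streak_pattern]
    have hpt : ∀ x : UnitAddTorus (Fin 3), ⟪r j x • EuclideanSpace.single (0 : Fin 3) (1 : ℝ) + (-1 : ℝ) • EuclideanSpace.single (2 : Fin 3) (1 : ℝ),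
        (-1 : ℝ) • ((2 * Real.pi * ((1 : ℕ) : ℝ) * ((UnitAddTorus.mFourier (Pi.single (1 : Fin 3) ((1 : ℕ) : ℤ)) x).im * (UnitAddTorus.mFourier (Pi.single (2 : Fin 3) ((1 : ℕ) : ℤ)) x).re)) • EuclideanSpace.single (0 : Fin 3) (1 : ℝ))⟫ =
        (-(2 * Real.pi * a j)) * ⟪((1 : ℝ) * (UnitAddTorus.mFourier (Pi.single (1 : Fin 3) ((1 : ℕ) : ℤ)) x).im * (UnitAddTorus.mFourier (Pi.single (2 : Fin 3) ((1 : ℕ) : ℤ)) x).re) • EuclideanSpace.single (0 : Fin 3) (1 : ℝ),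
          ((UnitAddTorus.mFourier (Pi.single (1 : Fin 3) ((1 : ℕ) : ℤ)) x).im * (UnitAddTorus.mFourier (Pi.single (2 : Fin 3) ((1 : ℕ) : ℤ)) x).re) • EuclideanSpace.single (0 : Fin 3) (1 : ℝ)⟫ := by
      intro x
      simp only [hrdef, inner_add_left, inner_smul_left, inner_smul_right,
        EuclideanSpace.inner_single_right, PiLp.single_apply]
      simp
      ring
    simp_rw [hpt]
    rw [integral_const_mul, LongitudinalQuiet.integral_inner_force_copattern 1 1 one_ne_zero]
    simp
  -- assemble
  refine ⟨1, 1, 1, 1, one_pos, one_pos, one_pos, one_pos, Λ, ν, U, fun j _ => U j, hν,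
    tendsto_one_div_add_atTop_nhds_zero_nat, fun j => ?_, fun j => ⟨_, fun t _ => le_rfl⟩, fun j => ?_,
    2 * Real.pi * 4⁻¹ / κ2, by positivity, fun j => ?_⟩
  · -- Leray–Hopf
    exact (hNS j).isGlobalLerayHopf
  · -- no leakage (equality), as for the drifted laminar family
    have hsm : IsSmooth (U j) := (hNS j).smooth_velocity.isSmooth_slice (Set.mem_univ (0 : ℝ))
    have hE := (hNS j).energy_eq convex_univ (zero_le_one (α := ℝ)) (Set.subset_univ _)
    simp only [intervalIntegral.integral_const, sub_zero, one_smul] at hE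
    change longTimeAvgSup (fun _ : ℝ => ∫ x, ⟪((1 : ℝ) * (UnitAddTorus.mFourier (Pi.single (1 : Fin 3) ((1 : ℕ) : ℤ)) x).im * (UnitAddTorus.mFourier (Pi.single (2 : Fin 3) ((1 : ℕ) : ℤ)) x).re) • EuclideanSpace.single (0 : Fin 3) (1 : ℝ), U j x⟫) ≤
      meanDissipation (ν j) (fun _ : ℝ => U j)
    rw [show longTimeAvgSup _ = _ from (steady_tendsto_timeMean_const _).limsup_eq,
      LaminarCalibration.meanDissipation_steady (ν j) hsm]
    linarith
  · -- the floor: `−T_s = 2π a_j/4 = 2π/(4 ν_j κ²) ≥ 2π/(4κ²)` since `ν_j ≤ 1`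
    change 2 * Real.pi * 4⁻¹ / κ2 ≤ -Λ.longTimeAvg (fun _ : ℝ => ∫ x, ⟪U j x - (1 : ℝ) • EuclideanSpace.single (2 : Fin 3) (1 : ℝ),
      convect (fun y => U j y - (1 : ℝ) • EuclideanSpace.single (2 : Fin 3) (1 : ℝ)) (fun y : UnitAddTorus (Fin 3) => ((UnitAddTorus.mFourier (Pi.single (1 : Fin 3) ((1 : ℕ) : ℤ)) y).im * (UnitAddTorus.mFourier (Pi.single (2 : Fin 3) ((1 : ℕ) : ℤ)) y).im) • EuclideanSpace.single (0 : Fin 3) (1 : ℝ)) x⟫)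
    rw [hstress j, steady_longTimeAvg_const, neg_neg, hadef]
    have hνle : ν j ≤ 1 := by
      rw [hνdef]
      rw [div_le_one (by positivity)]
      linarith [(Nat.cast_nonneg j : (0 : ℝ) ≤ j)]
    rw [div_le_iff₀ hκ2]
    have : 2 * Real.pi * (1 / (ν j * κ2)) * 4⁻¹ * κ2 = 2 * Real.pi * 4⁻¹ / ν j := by
      field_simp
    rw [this, le_div_iff₀ (hν j)]
    nlinarith [Real.pi_pos, hνle]

/-! ### (e) The guards `0 < m`, `0 < n`: degenerate patterns -/

/-- At `m = 0` the streak pattern `Ψ_s = sin(2π·0·x₁) sin(2πn x₂) e₀` vanishes identically, so the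
quadrature stress of EVERY field is zero at every time. [folklore] -/
theorem stress_eq_zero_of_m_eq_zero (n : ℕ) (V : ℝ) (v : UnitAddTorus (Fin 3) → EuclideanSpace ℝ (Fin 3)) :
    ∫ x, ⟪v x - V • EuclideanSpace.single (2 : Fin 3) (1 : ℝ), convect (fun y => v y - V • EuclideanSpace.single (2 : Fin 3) (1 : ℝ))
      (fun y : UnitAddTorus (Fin 3) => ((UnitAddTorus.mFourier (Pi.single (1 : Fin 3) ((0 : ℕ) : ℤ)) y).im * (UnitAddTorus.mFourier (Pi.single (2 : Fin 3) ((n : ℕ) : ℤ)) y).im) • EuclideanSpace.single (0 : Fin 3) (1 : ℝ)) x⟫ = 0 := by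
  have hΨ : (fun y : UnitAddTorus (Fin 3) => ((UnitAddTorus.mFourier (Pi.single (1 : Fin 3) ((0 : ℕ) : ℤ)) y).im * (UnitAddTorus.mFourier (Pi.single (2 : Fin 3) ((n : ℕ) : ℤ)) y).im) • EuclideanSpace.single (0 : Fin 3) (1 : ℝ)) = fun _ => (0 : EuclideanSpace ℝ (Fin 3)) := by
    funext y
    simp [UnitAddTorus.mFourier_zero]
  rw [hΨ]
  simp [convect_fun_const]

/-- At `n = 0` the streak pattern `Ψ_s = sin(2πm x₁) sin(2π·0·x₂) e₀` vanishes identically, so the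
quadrature stress of EVERY field is zero at every time. [folklore] -/
theorem stress_eq_zero_of_n_eq_zero (m : ℕ) (V : ℝ) (v : UnitAddTorus (Fin 3) → EuclideanSpace ℝ (Fin 3)) :
    ∫ x, ⟪v x - V • EuclideanSpace.single (2 : Fin 3) (1 : ℝ), convect (fun y => v y - V • EuclideanSpace.single (2 : Fin 3) (1 : ℝ))
      (fun y : UnitAddTorus (Fin 3) => ((UnitAddTorus.mFourier (Pi.single (1 : Fin 3) ((m : ℕ) : ℤ)) y).im * (UnitAddTorus.mFourier (Pi.single (2 : Fin 3) ((0 : ℕ) : ℤ)) y).im) • EuclideanSpace.single (0 : Fin 3) (1 : ℝ)) x⟫ = 0 := by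
  have hΨ : (fun y : UnitAddTorus (Fin 3) => ((UnitAddTorus.mFourier (Pi.single (1 : Fin 3) ((m : ℕ) : ℤ)) y).im * (UnitAddTorus.mFourier (Pi.single (2 : Fin 3) ((0 : ℕ) : ℤ)) y).im) • EuclideanSpace.single (0 : Fin 3) (1 : ℝ)) = fun _ => (0 : EuclideanSpace ℝ (Fin 3)) := by
    funext y
    simp [UnitAddTorus.mFourier_zero]
  rw [hΨ]
  simp [convect_fun_const]

/-- **The matrix of C1 is false at `m = 0`** (every `F`, `V`, `n`, `Λ`, every family): the floor clause
alone is unsatisfiable because `T_s ≡ 0`. The guard `0 < m` is necessary, not cosmetic (at `m = 0`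
the force vanishes too). [folklore] -/
theorem not_stressFloor_of_m_eq_zero (n : ℕ) (V : ℝ) (Λ : GeneralizedLimit) (u : ℕ → ℝ → UnitAddTorus (Fin 3) → EuclideanSpace ℝ (Fin 3)) :
    ¬ ∃ ε₀ : ℝ, 0 < ε₀ ∧ ∀ j, ε₀ ≤ -Λ.longTimeAvg (fun t => ∫ x, ⟪u j t x - V • EuclideanSpace.single (2 : Fin 3) (1 : ℝ),
      convect (fun y => u j t y - V • EuclideanSpace.single (2 : Fin 3) (1 : ℝ)) (fun y : UnitAddTorus (Fin 3) => ((UnitAddTorus.mFourier (Pi.single (1 : Fin 3) ((0 : ℕ) : ℤ)) y).im * (UnitAddTorus.mFourier (Pi.single (2 : Fin 3) ((n : ℕ) : ℤ)) y).im) • EuclideanSpace.single (0 : Fin 3) (1 : ℝ)) x⟫) := by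
  rintro ⟨ε₀, hε₀, hfloor⟩
  have h0 := hfloor 0
  simp_rw [stress_eq_zero_of_m_eq_zero] at h0
  rw [steady_longTimeAvg_const Λ 0, neg_zero] at h0
  exact absurd h0 (not_le.2 hε₀)

/-- **The matrix of C1 is false at `n = 0`** (every `F`, `V`, `m`, `Λ`, every family): `T_s ≡ 0`.
The guard `0 < n` is necessary (at `n = 0` the force `F sin(2πm x₁) e₀` is a genuine Kolmogorov
force, but the quadrature pattern and the Doppler clock `2πnV` degenerate). [folklore] -/
theorem not_stressFloor_of_n_eq_zero (m : ℕ) (V : ℝ) (Λ : GeneralizedLimit) (u : ℕ → ℝ → UnitAddTorus (Fin 3) → EuclideanSpace ℝ (Fin 3)) :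
    ¬ ∃ ε₀ : ℝ, 0 < ε₀ ∧ ∀ j, ε₀ ≤ -Λ.longTimeAvg (fun t => ∫ x, ⟪u j t x - V • EuclideanSpace.single (2 : Fin 3) (1 : ℝ),
      convect (fun y => u j t y - V • EuclideanSpace.single (2 : Fin 3) (1 : ℝ)) (fun y : UnitAddTorus (Fin 3) => ((UnitAddTorus.mFourier (Pi.single (1 : Fin 3) ((m : ℕ) : ℤ)) y).im * (UnitAddTorus.mFourier (Pi.single (2 : Fin 3) ((0 : ℕ) : ℤ)) y).im) • EuclideanSpace.single (0 : Fin 3) (1 : ℝ)) x⟫) := by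
  rintro ⟨ε₀, hε₀, hfloor⟩
  have h0 := hfloor 0
  simp_rw [stress_eq_zero_of_n_eq_zero] at h0
  rw [steady_longTimeAvg_const Λ 0, neg_zero] at h0
  exact absurd h0 (not_le.2 hε₀)

end Summit.AnomalousDissipation.AnomalousDissipation.Theorems.QuadratureStressFloor.Negative

end
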